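import Summits.QuantumFields.YangMills.Theorems.VirialFluxGapResolventFieldMatrix
import HarnessLib

/-!
# Route `VirialFluxGap` (YangMills): the RESOLVENT EULER FIELD — abstract matrix layer, II (the two consumable estimates)

Continuation of ✓`VirialFluxGapResolventFieldMatrix` (item stmt-QuantumFields-24141, generic-region Euler field
`X_g = ½(H + λ⋆)⁻¹g` in the right-translation frame).  With `A = H + λ⋆·1`, `Hᵀ = H`, floor `c|v|² ≤ vᵀAv`:

* §4 `inv_mulVec_grad_sq_le` — `|A⁻¹g|² ≤ 3((1 + λ⋆²/c²)|u|² + |r|²/c²)` for `g = r − Hu`;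
  ★ `deriv_term_sq_le` — the `∂(A⁻¹)` part of the divergence: `(Σ_i (A⁻¹ B_i w)_i)² ≤ #ι²·(b²/c²)·|w|²` for matrices `B_i` (the
  third derivatives `∂_iH`) with `|B_i v|² ≤ b²|v|²`;
* §5 ★★★ `drive_lower_of_taylor` — `½gᵀA⁻¹g ≥ (1 − η − ((M+M₃)d + λ⋆/2 + M²d²/(2ηc))/κ)·F` when
  `F = ½uᵀHu − rᵀu + ρ₃` (second-order Taylor along the one-parameter subgroup reaching a zero of `F₀`), `|u|² ≤ d²`,
  `|r|² ≤ M²d⁴`, `|ρ₃| ≤ M₃d³` and the QUADRATIC GROWTH `κd² ≤ F`;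
  ★★★ `divergence_upper` — `½tr(A⁻¹H) − ½Σ_i(A⁻¹B_iA⁻¹g)_i ≤ ½(#ι − m) + ½·m·s/(s+λ⋆) + ½·#ι·(b/c)·√(3((1+λ⋆²/c²)d² + M²d⁴/c²))`.

With `#ι = 18L⁴ + 3L³`, `m = 3L³ + 3`, `λ⋆ = κ·o(L⁻⁴)`, `d ≤ √(t₀/κ)`, `t₀ = 1/poly(L)` these read `X_g·F₀ ≥ (1 − o(L⁻⁴))F₀` and
`div X_g ≤ 9L⁴ − 3/2 + o(1)` pointwise on `{F₀ ≤ t₀}` ∩ {generic} — the two clauses of the «EulerField» hypothesis of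
✓`periodicSoftness_of_eulerField` (in w3's normalisation `X = 2X_g`: `X·F₀ ≥ 2(1−ε)F₀`, `div X ≤ 18L⁴ − 3 + o(1)`).

HONEST FRAMING: helper linear algebra; the field itself is NOT constructed here; ⟨24141⟩ stays OPEN; no stub / crux / rung / summit
is closed; the Yang–Mills mass gap is NOT proved; no summit is proved by a line.  THEOREMS ONLY (0 `def`, 0 `sorry`), standard
axioms.  Explicit-unit seat `ym-line-fcl-p3` g40 (cell ym-idea-1, free hands), `--supports stmt-QuantumFields-24141`.
References: [folklore].
-/

set_option autoImplicit false

open Matrix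
open scoped BigOperators

namespace Summit.QuantumFields.YangMills.Theorems.VirialFluxGap.ResolventField

variable {ι : Type*} [Fintype ι] [DecidableEq ι]

/-! ## §4 The derivative term of the divergence -/

/-- Bound for the resolvent applied to the gradient: with `g = r − Hu`, `A⁻¹g = A⁻¹r − (u − λ⋆A⁻¹u)`, so
`|A⁻¹g|² ≤ 3·(|u|² + λ⋆²|A⁻¹u|² + |A⁻¹r|²) ≤ 3·((1 + λ⋆²/c²)|u|² + |r|²/c²)`. [folklore] -/
theorem inv_mulVec_grad_sq_le {H : Matrix ι ι ℝ} {lam c : ℝ} (hc : 0 < c)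
    (hfl : ∀ v, c * (v ⬝ᵥ v) ≤ v ⬝ᵥ ((H + lam • (1 : Matrix ι ι ℝ)) *ᵥ v)) {u r g : ι → ℝ} (hg : g = r - H *ᵥ u) :
    ((H + lam • (1 : Matrix ι ι ℝ))⁻¹ *ᵥ g) ⬝ᵥ ((H + lam • (1 : Matrix ι ι ℝ))⁻¹ *ᵥ g) ≤
      3 * ((1 + lam ^ 2 / c ^ 2) * (u ⬝ᵥ u) + (r ⬝ᵥ r) / c ^ 2) := by
  set A := H + lam • (1 : Matrix ι ι ℝ) with hAdef
  have hHu : H *ᵥ u = A *ᵥ u - lam • u := by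
    rw [hAdef, add_mulVec, smul_mulVec, one_mulVec]; abel
  have hdec : A⁻¹ *ᵥ g = A⁻¹ *ᵥ r - u + lam • (A⁻¹ *ᵥ u) := by
    rw [hg, mulVec_sub, hHu, mulVec_sub, inv_mulVec_mulVec hc hfl, mulVec_smul]; abel
  have h1 := inv_mulVec_sq_le hc hfl u
  have h2 := inv_mulVec_sq_le hc hfl r
  set a := A⁻¹ *ᵥ r
  set b := A⁻¹ *ᵥ u
  -- `|a − u + λ b|² ≤ 3(|a|² + |u|² + λ²|b|²)`
  have h3 : (a - u + lam • b) ⬝ᵥ (a - u + lam • b) ≤ 3 * (a ⬝ᵥ a + u ⬝ᵥ u + lam ^ 2 * (b ⬝ᵥ b)) := by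
    have e : (a - u + lam • b) ⬝ᵥ (a - u + lam • b) + ((a + u) ⬝ᵥ (a + u) + (a - lam • b) ⬝ᵥ (a - lam • b)
        + (u + lam • b) ⬝ᵥ (u + lam • b)) = 3 * (a ⬝ᵥ a + u ⬝ᵥ u + lam ^ 2 * (b ⬝ᵥ b)) := by
      simp only [add_dotProduct, dotProduct_add, sub_dotProduct, dotProduct_sub, smul_dotProduct, dotProduct_smul, smul_eq_mul,
        dotProduct_comm u a, dotProduct_comm b a, dotProduct_comm b u]
      ring
    have h₁ : 0 ≤ (a + u) ⬝ᵥ (a + u) := dpnn _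
    have h₂ : 0 ≤ (a - lam • b) ⬝ᵥ (a - lam • b) := dpnn _
    have h₃ : 0 ≤ (u + lam • b) ⬝ᵥ (u + lam • b) := dpnn _
    linarith
  rw [hdec]
  have hc2 : 0 < c ^ 2 := pow_pos hc 2
  have hb : b ⬝ᵥ b ≤ (u ⬝ᵥ u) / c ^ 2 := by rw [le_div_iff₀ hc2]; linarith
  have ha : a ⬝ᵥ a ≤ (r ⬝ᵥ r) / c ^ 2 := by rw [le_div_iff₀ hc2]; linarith
  have hl2 : 0 ≤ lam ^ 2 := sq_nonneg _
  have := mul_le_mul_of_nonneg_left hb hl2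
  have euu : (1 + lam ^ 2 / c ^ 2) * (u ⬝ᵥ u) = u ⬝ᵥ u + lam ^ 2 * ((u ⬝ᵥ u) / c ^ 2) := by ring
  nlinarith

/-- ★ THE DERIVATIVE TERM.  For matrices `B_i` (`i : ι`; the third derivatives `∂_iH`) with `|B_i v|² ≤ b²|v|²` (`b ≥ 0`) and `A`
with floor `c`: `|Σ_i (A⁻¹ B_i A⁻¹ g)_i| ≤ #ι · (b/c) · |A⁻¹g|` (stated in squared form:
`(Σ_i (A⁻¹ B_i w)_i)² ≤ #ι² · (b²/c²) · |w|²` for any `w`, used with `w = A⁻¹g`). [folklore] -/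
theorem deriv_term_sq_le {A : Matrix ι ι ℝ} {c b : ℝ} (hc : 0 < c)
    (hfl : ∀ v, c * (v ⬝ᵥ v) ≤ v ⬝ᵥ (A *ᵥ v)) (Bm : ι → Matrix ι ι ℝ)
    (hB : ∀ i v, (Bm i *ᵥ v) ⬝ᵥ (Bm i *ᵥ v) ≤ b ^ 2 * (v ⬝ᵥ v)) (w : ι → ℝ) :
    (∑ i, (A⁻¹ *ᵥ (Bm i *ᵥ w)) i) ^ 2 ≤ (Fintype.card ι : ℝ) ^ 2 * (b ^ 2 / c ^ 2) * (w ⬝ᵥ w) := by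
  -- each term: `((A⁻¹ B_i w)_i)² ≤ |A⁻¹ B_i w|² ≤ |B_i w|²/c² ≤ b²|w|²/c²`
  have hc2 : 0 < c ^ 2 := pow_pos hc 2
  have hww : 0 ≤ w ⬝ᵥ w := (dpnn w)
  set T : ℝ := b ^ 2 / c ^ 2 * (w ⬝ᵥ w) with hT
  have hT0 : 0 ≤ T := by positivity
  have heach : ∀ i, ((A⁻¹ *ᵥ (Bm i *ᵥ w)) i) ^ 2 ≤ T := by
    intro i
    have h1 := sq_apply_le_dotProduct (A⁻¹ *ᵥ (Bm i *ᵥ w)) i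
    have h2 := inv_mulVec_sq_le hc hfl (Bm i *ᵥ w)
    have h3 := hB i w
    have h4 : (A⁻¹ *ᵥ (Bm i *ᵥ w)) ⬝ᵥ (A⁻¹ *ᵥ (Bm i *ᵥ w)) ≤ T := by
      rw [hT, div_mul_eq_mul_div, le_div_iff₀ hc2]; linarith
    exact h1.trans h4
  -- `|x_i| ≤ √T` ⇒ `(Σ x_i)² ≤ (#ι √T)² = #ι² T`
  have habs : ∀ i, |(A⁻¹ *ᵥ (Bm i *ᵥ w)) i| ≤ Real.sqrt T := fun i =>
    Real.abs_le_sqrt (heach i)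
  have hs : |∑ i, (A⁻¹ *ᵥ (Bm i *ᵥ w)) i| ≤ (Fintype.card ι : ℝ) * Real.sqrt T := by
    calc |∑ i, (A⁻¹ *ᵥ (Bm i *ᵥ w)) i| ≤ ∑ i, |(A⁻¹ *ᵥ (Bm i *ᵥ w)) i| := Finset.abs_sum_le_sum_abs _ _
      _ ≤ ∑ _i : ι, Real.sqrt T := Finset.sum_le_sum fun i _ => habs i
      _ = (Fintype.card ι : ℝ) * Real.sqrt T := by simp
  have hsq : (∑ i, (A⁻¹ *ᵥ (Bm i *ᵥ w)) i) ^ 2 ≤ ((Fintype.card ι : ℝ) * Real.sqrt T) ^ 2 := by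
    have h0 : 0 ≤ (Fintype.card ι : ℝ) * Real.sqrt T := by positivity
    exact sq_le_sq' (by linarith [neg_abs_le (∑ i, (A⁻¹ *ᵥ (Bm i *ᵥ w)) i), hs]) (le_trans (le_abs_self _) hs)
  calc (∑ i, (A⁻¹ *ᵥ (Bm i *ᵥ w)) i) ^ 2 ≤ ((Fintype.card ι : ℝ) * Real.sqrt T) ^ 2 := hsq
    _ = (Fintype.card ι : ℝ) ^ 2 * T := by rw [mul_pow, Real.sq_sqrt hT0]
    _ = (Fintype.card ι : ℝ) ^ 2 * (b ^ 2 / c ^ 2) * (w ⬝ᵥ w) := by rw [hT]; ring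

/-! ## §5 The two pointwise estimates in consumable form -/

/-- ★★★ THE DRIVING ESTIMATE WITH TAYLOR DATA.  Let `A = H + λ⋆·1` be symmetric with floor `c`, `0 < η < 1`, `κ > 0`, `λ⋆ ≥ 0`.
Suppose `g = r − Hu` and the value `F ≥ 0` satisfies the second-order Taylor relation `F = ½uᵀHu − rᵀu + ρ₃` (expansion at the point
along the one-parameter subgroup reaching a zero of `F₀`), with `|u|² ≤ d²`, `|r|² ≤ M²d⁴`, `|ρ₃| ≤ M₃d³` and the QUADRATIC GROWTH
`κ·d² ≤ F`.  Then `½gᵀA⁻¹g ≥ (1 − η − ((M + M₃)·d + λ⋆/2 + M²d²/(2ηc))/κ)·F` — i.e. `X_g·F₀ ≥ (1 − o(1))F₀` once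
`λ⋆ ≪ κ`, `d ≪ κ/(M+M₃)` and `d² ≪ ηcκ/M²`. [folklore] -/
theorem drive_lower_of_taylor {H : Matrix ι ι ℝ} (hH : Hᵀ = H) {lam c η κ : ℝ} (hlam : 0 ≤ lam) (hc : 0 < c) (hη : 0 < η)
    (hη1 : η < 1) (hκ : 0 < κ) (hfl : ∀ v, c * (v ⬝ᵥ v) ≤ v ⬝ᵥ ((H + lam • (1 : Matrix ι ι ℝ)) *ᵥ v))
    {u r g : ι → ℝ} (hg : g = r - H *ᵥ u) {F ρ₃ d M M₃ : ℝ} (hd : 0 ≤ d) (hM : 0 ≤ M) (hM₃ : 0 ≤ M₃)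
    (hF : F = (1 / 2) * (u ⬝ᵥ (H *ᵥ u)) - r ⬝ᵥ u + ρ₃) (huu : u ⬝ᵥ u ≤ d ^ 2) (hrr : r ⬝ᵥ r ≤ M ^ 2 * d ^ 4)
    (hρ : |ρ₃| ≤ M₃ * d ^ 3) (hqg : κ * d ^ 2 ≤ F) :
    (1 - η - ((M + M₃) * d + lam / 2 + M ^ 2 * d ^ 2 / (2 * η * c)) / κ) * F ≤
      (1 / 2) * (g ⬝ᵥ ((H + lam • (1 : Matrix ι ι ℝ))⁻¹ *ᵥ g)) := by
  have hdl := drive_lower hH hc hη hη1 hfl hg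
  -- `|r⬝u| ≤ M d³`
  have hru : |r ⬝ᵥ u| ≤ M * d ^ 3 := by
    have hcs := (dpcs r u)
    have h1 : (r ⬝ᵥ u) ^ 2 ≤ (M * d ^ 3) ^ 2 := by
      calc (r ⬝ᵥ u) ^ 2 ≤ (r ⬝ᵥ r) * (u ⬝ᵥ u) := hcs
        _ ≤ (M ^ 2 * d ^ 4) * d ^ 2 :=
          mul_le_mul hrr huu ((dpnn u)) (by positivity)
        _ = (M * d ^ 3) ^ 2 := by ring
    exact abs_le_of_sq_le_sq' h1 (by positivity) |> fun h => abs_le.2 h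
  have hF0 : 0 ≤ F := le_trans (by positivity) hqg
  have hη2 : 0 ≤ η⁻¹ - 1 := by rw [sub_nonneg]; exact (one_le_inv₀ hη).2 hη1.le
  have hηinv : η⁻¹ - 1 ≤ η⁻¹ := by linarith
  -- assemble: `½(1−η)(uHu − λ|u|²) − ½(η⁻¹−1)|r|²/c ≥ (1−η)F − |r u| − |ρ₃| − ½λd² − M²d⁴/(2ηc)`
  have huHu : (1 / 2) * (u ⬝ᵥ (H *ᵥ u)) = F + r ⬝ᵥ u - ρ₃ := by rw [hF]; ring
  have hrrc : (r ⬝ᵥ r) / c ≤ M ^ 2 * d ^ 4 / c := div_le_div_of_nonneg_right hrr hc.le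
  have hstep : (1 - η) * F - M * d ^ 3 - M₃ * d ^ 3 - lam / 2 * d ^ 2 - M ^ 2 * d ^ 4 / (2 * η * c) ≤
      (1 / 2) * (g ⬝ᵥ ((H + lam • (1 : Matrix ι ι ℝ))⁻¹ *ᵥ g)) := by
    have e1 : (1 - η) * (u ⬝ᵥ (H *ᵥ u) - lam * (u ⬝ᵥ u)) =
        2 * (1 - η) * (F + r ⬝ᵥ u - ρ₃) - (1 - η) * lam * (u ⬝ᵥ u) := by rw [← huHu]; ring
    have hru' : -(M * d ^ 3) ≤ r ⬝ᵥ u := by linarith [(abs_le.1 hru).1]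
    have hρ' : ρ₃ ≤ M₃ * d ^ 3 := le_trans (le_abs_self _) hρ
    have hA1 : (1 - η) * (F + r ⬝ᵥ u - ρ₃) ≥ (1 - η) * F - M * d ^ 3 - M₃ * d ^ 3 := by
      have : (1 - η) * (r ⬝ᵥ u - ρ₃) ≥ -(M * d ^ 3) - M₃ * d ^ 3 := by
        have hlow : -(M * d ^ 3) - M₃ * d ^ 3 ≤ r ⬝ᵥ u - ρ₃ := by linarith
        have hneg : -(M * d ^ 3) - M₃ * d ^ 3 ≤ 0 := by
          have : 0 ≤ M * d ^ 3 := by positivity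
          have : 0 ≤ M₃ * d ^ 3 := by positivity
          linarith
        nlinarith
      linarith
    have hA2 : (1 - η) * lam * (u ⬝ᵥ u) ≤ lam * d ^ 2 := by
      have : lam * (u ⬝ᵥ u) ≤ lam * d ^ 2 := mul_le_mul_of_nonneg_left huu hlam
      have : 0 ≤ lam * (u ⬝ᵥ u) := mul_nonneg hlam ((dpnn u))
      nlinarith
    have hA3 : (η⁻¹ - 1) * ((r ⬝ᵥ r) / c) ≤ η⁻¹ * (M ^ 2 * d ^ 4 / c) := by
      have h0 : 0 ≤ (r ⬝ᵥ r) / c := div_nonneg ((dpnn r)) hc.le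
      calc (η⁻¹ - 1) * ((r ⬝ᵥ r) / c) ≤ η⁻¹ * ((r ⬝ᵥ r) / c) := mul_le_mul_of_nonneg_right hηinv h0
        _ ≤ η⁻¹ * (M ^ 2 * d ^ 4 / c) := mul_le_mul_of_nonneg_left hrrc (inv_pos.2 hη).le
    have e2 : η⁻¹ * (M ^ 2 * d ^ 4 / c) = 2 * (M ^ 2 * d ^ 4 / (2 * η * c)) := by
      field_simp
    rw [e1] at hdl
    linarith
  -- quadratic growth turns the error terms into a multiple of `F`
  have hd2 : d ^ 2 ≤ F / κ := by rw [le_div_iff₀ hκ]; linarith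
  have hd3 : d ^ 3 ≤ d * (F / κ) := by
    calc d ^ 3 = d * d ^ 2 := by ring
      _ ≤ d * (F / κ) := mul_le_mul_of_nonneg_left hd2 hd
  have hd4 : d ^ 4 ≤ d ^ 2 * (F / κ) := by
    calc d ^ 4 = d ^ 2 * d ^ 2 := by ring
      _ ≤ d ^ 2 * (F / κ) := mul_le_mul_of_nonneg_left hd2 (by positivity)
  have hB1 : M * d ^ 3 + M₃ * d ^ 3 ≤ (M + M₃) * d * (F / κ) := by nlinarith
  have hB2 : lam / 2 * d ^ 2 ≤ lam / 2 * (F / κ) := mul_le_mul_of_nonneg_left hd2 (by positivity)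
  have hB3 : M ^ 2 * d ^ 4 / (2 * η * c) ≤ M ^ 2 * d ^ 2 / (2 * η * c) * (F / κ) := by
    have h0 : 0 ≤ M ^ 2 / (2 * η * c) := by positivity
    have := mul_le_mul_of_nonneg_left hd4 h0
    calc M ^ 2 * d ^ 4 / (2 * η * c) = M ^ 2 / (2 * η * c) * d ^ 4 := by ring
      _ ≤ M ^ 2 / (2 * η * c) * (d ^ 2 * (F / κ)) := this
      _ = M ^ 2 * d ^ 2 / (2 * η * c) * (F / κ) := by ring
  have e3 : (1 - η - ((M + M₃) * d + lam / 2 + M ^ 2 * d ^ 2 / (2 * η * c)) / κ) * F =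
      (1 - η) * F - ((M + M₃) * d * (F / κ) + lam / 2 * (F / κ) + M ^ 2 * d ^ 2 / (2 * η * c) * (F / κ)) := by
    field_simp
  rw [e3]
  linarith

/-- ★★★ THE DIVERGENCE ESTIMATE.  With `A = H + λ⋆·1` (floor `c`, `λ⋆ > 0`), an orthonormal approximate-kernel family `k_a`
(`a : Fin m`, `k_aᵀHk_a ≤ s`), third-derivative matrices `B_i` with `|B_iv|² ≤ b²|v|²`, and `g = r − Hu` with `|u|² ≤ d²`,
`|r|² ≤ M²d⁴`:  `½tr(A⁻¹H) − ½Σ_i(A⁻¹B_iA⁻¹g)_i ≤ ½(#ι − m) + ½·m·s/(s+λ⋆) + ½·#ι·(b/c)·√(3((1 + λ⋆²/c²)d² + M²d⁴/c²))`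
— i.e. `div X_g ≤ ½(#ι − m) + o(1)` once `s ≪ λ⋆` and `d ≪ c/(#ι·b)`. [folklore] -/
theorem divergence_upper {H : Matrix ι ι ℝ} (hH : Hᵀ = H) {lam c s b : ℝ} (hlam : 0 < lam) (hc : 0 < c) (hs : 0 ≤ s)
    (hb : 0 ≤ b) (hfl : ∀ v, c * (v ⬝ᵥ v) ≤ v ⬝ᵥ ((H + lam • (1 : Matrix ι ι ℝ)) *ᵥ v)) {m : ℕ} (k : Fin m → ι → ℝ)
    (hon : ∀ a a', k a ⬝ᵥ k a' = if a = a' then 1 else 0) (hker : ∀ a, k a ⬝ᵥ (H *ᵥ k a) ≤ s)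
    (Bm : ι → Matrix ι ι ℝ) (hB : ∀ i v, (Bm i *ᵥ v) ⬝ᵥ (Bm i *ᵥ v) ≤ b ^ 2 * (v ⬝ᵥ v))
    {u r g : ι → ℝ} (hg : g = r - H *ᵥ u) {d M : ℝ} (huu : u ⬝ᵥ u ≤ d ^ 2)
    (hrr : r ⬝ᵥ r ≤ M ^ 2 * d ^ 4) :
    (1 / 2) * Matrix.trace ((H + lam • (1 : Matrix ι ι ℝ))⁻¹ * H) -
        (1 / 2) * ∑ i, ((H + lam • (1 : Matrix ι ι ℝ))⁻¹ *ᵥ (Bm i *ᵥ ((H + lam • (1 : Matrix ι ι ℝ))⁻¹ *ᵥ g))) i ≤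
      (1 / 2) * ((Fintype.card ι : ℝ) - m) + (1 / 2) * (m * (s / (s + lam))) +
        (1 / 2) * ((Fintype.card ι : ℝ) * (b / c) * Real.sqrt (3 * ((1 + lam ^ 2 / c ^ 2) * d ^ 2 + M ^ 2 * d ^ 4 / c ^ 2))) := by
  set A := H + lam • (1 : Matrix ι ι ℝ) with hAdef
  have htr := trace_resolvent_le hH hlam hc hs hfl k hon hker
  set w := A⁻¹ *ᵥ g with hw
  have hsq := deriv_term_sq_le hc hfl Bm hB w
  have hw2 := inv_mulVec_grad_sq_le hc hfl hg
  -- `|w|² ≤ 3((1+λ²/c²)d² + M²d⁴/c²) =: W`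
  set W : ℝ := 3 * ((1 + lam ^ 2 / c ^ 2) * d ^ 2 + M ^ 2 * d ^ 4 / c ^ 2) with hW
  have hwW : w ⬝ᵥ w ≤ W := by
    have h1 : (1 + lam ^ 2 / c ^ 2) * (u ⬝ᵥ u) ≤ (1 + lam ^ 2 / c ^ 2) * d ^ 2 :=
      mul_le_mul_of_nonneg_left huu (by positivity)
    have h2 : (r ⬝ᵥ r) / c ^ 2 ≤ M ^ 2 * d ^ 4 / c ^ 2 := div_le_div_of_nonneg_right hrr (by positivity)
    rw [hW]; linarith
  have hW0 : 0 ≤ W := le_trans ((dpnn w)) hwW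
  -- `|Σ| ≤ #ι (b/c) √W`
  set S := ∑ i, (A⁻¹ *ᵥ (Bm i *ᵥ w)) i with hS
  have hS2 : S ^ 2 ≤ ((Fintype.card ι : ℝ) * (b / c) * Real.sqrt W) ^ 2 := by
    calc S ^ 2 ≤ (Fintype.card ι : ℝ) ^ 2 * (b ^ 2 / c ^ 2) * (w ⬝ᵥ w) := hsq
      _ ≤ (Fintype.card ι : ℝ) ^ 2 * (b ^ 2 / c ^ 2) * W := mul_le_mul_of_nonneg_left hwW (by positivity)
      _ = ((Fintype.card ι : ℝ) * (b / c) * Real.sqrt W) ^ 2 := by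
        rw [mul_pow, mul_pow, div_pow, Real.sq_sqrt hW0]
  have hS : |S| ≤ (Fintype.card ι : ℝ) * (b / c) * Real.sqrt W := by
    have h0 : 0 ≤ (Fintype.card ι : ℝ) * (b / c) * Real.sqrt W := by positivity
    exact abs_le_of_sq_le_sq' hS2 h0 |> fun h => abs_le.2 h
  have hSlow : -S ≤ (Fintype.card ι : ℝ) * (b / c) * Real.sqrt W := by linarith [(abs_le.1 hS).1]
  linarith

end Summit.QuantumFields.YangMills.Theorems.VirialFluxGap.ResolventField
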